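import Mathlib

/-!
# Lauter–Viray (1.5), second case: the exponent of ℓ on class-number-one instances (ENGINE B, P-LV17-F3)

certified instances and evidence bearing on the general Hodge conjecture; no claim.

ENGINE B (cell pub-hlocus, seat abs-2, gen 51) helper anchor for DERIVATIONS_engineB.md §69.11-F3.
Lauter–Viray, arXiv:1206.6942, display (1.5), case `ℓ ∣ cond(d₂)`: `v_ℓ(F(m)) = ρ(m)·𝔄(m/ℓ^{1+v(cond d₂)})`
with (for `cond(d₁) = 1`, `cond(d₂) = ℓ`)
`ρ(m) = 0` if `(d₁, −m)_p = −1` for some `p ∣ d₁`, `p ≠ ℓ`, else `2^{#{p ∣ (m, d₁)}}`, and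
`𝔄(N) = #{invertible ideals of O_{d₁} of norm N}`.
This file transcribes `ρ` and `𝔄` in the IDEAL-COUNTING form (not the local-factor table of the companion
anchor `HodgeLocusCensusLVInertCaseB`) and lets the kernel evaluate the x-sum
`caseTwo r ℓ d₁ d₂ = Σ_{x signed, m_x > 0} ρ(m_x)·𝔄(m_x/ℓ^r)` for BOTH exponents `r = 1` and `r = 2` on the
class-number-one pairs of §69.11 (`J(d₁,d₂) = j(d₁) − j(d₂)` an integer, factorised in the companion anchor):

* `r = 1`: `2, 2, 2, 8, 8, 6, 6, 6` on the eight pairs with `ℓ` inert in `ℚ(√d₁)` — equal to `v_ℓ(J²)`;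
  `0, 0, 0` on the three controls with `ℓ` split in one field (`J` prime to `ℓ`);
* `r = 2` (as printed, `1 + v_ℓ(cond d₂) = 2`): `0` on all eight inert pairs;
* both exponents give `10` on the ramified control `(−8, −32)` (`v₂(J²) = 12 = 10 + 2·h(−8)`).

The cell-level statement (exponent 1 fits all 22 723 machine pairs, the printed exponent exactly the 17 746 on
which the two coincide) is a computation record (P-LV17-F / -F2 / -F3), not a theorem of this file; the file
supports an ERRATUM CANDIDATE put to the cell's LEAD and referee, and claims nothing about the theorem itself.
-/

set_option linter.dupNamespace false

namespace Summit.HodgeConjecture.HodgeConjecture.HodgeLocus.Census.LVExponentB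

/-- `p`-adic valuation of a natural number by repeated division (fuel 80; `0 ↦ 0`). -/
def val (p n : ℕ) : ℕ := go n 80 where
  /-- fuelled recursion for `val`. -/
  go : ℕ → ℕ → ℕ
  | _, 0 => 0
  | n, fuel + 1 => if n = 0 ∨ p < 2 ∨ n % p ≠ 0 then 0 else 1 + go (n / p) fuel

/-- trial-division primality. -/
def isPrimeB (p : ℕ) : Bool := decide (2 ≤ p) && (List.range (p - 2)).all (fun i => p % (i + 2) != 0)

/-- the prime divisors of `n` (ascending). -/
def primesOf (n : ℕ) : List ℕ := (List.range (n + 1)).filter (fun p => n % p == 0 && isPrimeB p)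

/-- Kronecker symbol `(a / p)` at a prime `p` (Euler's criterion for odd `p`; the mod-8 rule at `p = 2`). -/
def kro (a : ℤ) (p : ℕ) : ℤ :=
  if p = 2 then (if a % 2 = 0 then 0 else if a % 8 = 1 ∨ a % 8 = 7 then 1 else -1)
  else
    let r := (a % (p : ℤ)).toNat
    if r = 0 then 0 else if r ^ ((p - 1) / 2) % p = 1 then 1 else -1

/-- the unit part of a nonzero integer at `p`. -/
def unitPart (a : ℤ) (p : ℕ) : ℤ := a / ((p : ℤ) ^ val p a.natAbs)

/-- Hilbert symbol `(a, b)_p` (`a, b ≠ 0`): odd `p` by `(−1)^{αβ(p−1)/2}(u/p)^β(v/p)^α`; `p = 2` by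
`(−1)^{ε(u)ε(v) + αω(v) + βω(u)}`, `ε(u) = (u−1)/2`, `ω(u) = (u²−1)/8`. -/
def hilb (a b : ℤ) (p : ℕ) : ℤ :=
  let α := val p a.natAbs
  let β := val p b.natAbs
  let u := unitPart a p
  let v := unitPart b p
  if p = 2 then
    (let e := fun t : ℤ => ((t % 8 - 1) / 2) % 2
     let w := fun t : ℤ => (((t % 8) * (t % 8) - 1) / 8) % 2
     (-1) ^ (e u * e v + (α : ℤ) * w v + (β : ℤ) * w u).toNat)
  else (-1) ^ (α * β * ((p - 1) / 2)) * (kro u p) ^ β * (kro v p) ^ α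

/-- `𝔄(N)`: the number of invertible ideals of norm `N ≥ 1` in `O_{d}` (`d` fundamental):
`∏_{p ∣ N}` of `1` (ramified), `1 + v_p(N)` (split), `[v_p(N) even]` (inert). -/
def idealCount (d : ℤ) (N : ℕ) : ℕ :=
  ((primesOf N).map (fun p =>
    let e := val p N
    if d % (p : ℤ) = 0 then 1 else if kro d p = 1 then 1 + e else (if e % 2 = 0 then 1 else 0))).prod

/-- `ρ(m)` of (1.5) for `cond(d₁) = 1`, `cond(d₂) = ℓ`: `0` if `(d₁, −m)_p = −1` for some prime `p ∣ d₁`,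
`p ≠ ℓ`; otherwise `2^{#{p ∣ gcd(m, d₁)}}`. -/
def rho (ℓ : ℕ) (d₁ : ℤ) (m : ℕ) : ℕ :=
  if ((primesOf d₁.natAbs).filter (fun p => p != ℓ)).any (fun p => hilb d₁ (-(m : ℤ)) p = -1) then 0
  else 2 ^ (primesOf (Nat.gcd m d₁.natAbs)).length

/-- the displayed second case summed over signed `x` with `m_x > 0`, with exponent `r`:
`Σ ρ(m_x)·𝔄(m_x/ℓ^r)` (`𝔄` of a non-integer is `0`). -/
def caseTwo (r ℓ : ℕ) (d₁ d₂ : ℤ) : ℕ :=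
  let D := (d₁ * d₂).toNat
  ((List.range (Nat.sqrt D + 1)).map (fun x =>
    (if x = 0 then 1 else 2) *
      (if x * x < D ∧ (D - x * x) % 4 = 0 then
        (let m := (D - x * x) / 4
         if m = 0 ∨ m % ℓ ^ r ≠ 0 then 0 else rho ℓ d₁ m * idealCount d₁ (m / ℓ ^ r))
       else 0))).sum

/-- exponent `r = 1`: the eight inert pairs give `v_ℓ(J²)` (`2·v_ℓ(J)` with `3 ‖ J(·,−27)`, `2⁴ ‖ J(·,−12)`,
`2³ ‖ J(·,−16)`), the three split controls give `0`. -/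
theorem exponent_one_values :
    caseTwo 1 3 (-7) (-27) = 2 ∧ caseTwo 1 3 (-19) (-27) = 2 ∧ caseTwo 1 3 (-43) (-27) = 2 ∧
    caseTwo 1 2 (-11) (-12) = 8 ∧ caseTwo 1 2 (-19) (-12) = 8 ∧
    caseTwo 1 2 (-11) (-16) = 6 ∧ caseTwo 1 2 (-19) (-16) = 6 ∧ caseTwo 1 2 (-43) (-16) = 6 ∧
    caseTwo 1 2 (-7) (-12) = 0 ∧ caseTwo 1 2 (-7) (-16) = 0 ∧ caseTwo 1 2 (-11) (-28) = 0 := by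
  decide +kernel

/-- exponent `r = 2` (as printed): `0` on all eight inert pairs (and on the split controls). -/
theorem exponent_two_values :
    caseTwo 2 3 (-7) (-27) = 0 ∧ caseTwo 2 3 (-19) (-27) = 0 ∧ caseTwo 2 3 (-43) (-27) = 0 ∧
    caseTwo 2 2 (-11) (-12) = 0 ∧ caseTwo 2 2 (-19) (-12) = 0 ∧
    caseTwo 2 2 (-11) (-16) = 0 ∧ caseTwo 2 2 (-19) (-16) = 0 ∧ caseTwo 2 2 (-43) (-16) = 0 ∧
    caseTwo 2 2 (-7) (-12) = 0 ∧ caseTwo 2 2 (-7) (-16) = 0 ∧ caseTwo 2 2 (-11) (-28) = 0 := by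
  decide +kernel

/-- the ramified control `(−8, −32)` (2 ramified in `ℚ(√−8)`): both exponents give `10`, and
`10 + 2·h(−8) = 12 = v₂(J(−8,−32)²)` (`J(−8,−32) = −2⁶·5⁶·405769`, companion anchor). -/
theorem ramified_control : caseTwo 1 2 (-8) (-32) = 10 ∧ caseTwo 2 2 (-8) (-32) = 10 := by
  decide +kernel

/-- the smallest instance unpacked: for `(d₁,d₂,ℓ) = (−7,−27,3)` the only `x ≥ 0` with a non-zero term at
exponent 1 is `x = 9`, `m = 27`: `ρ(27) = 1`, `𝔄(9) = 1`, while `𝔄(3) = 0` (3 inert in `ℚ(√−7)`). -/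
theorem smallest_instance :
    rho 3 (-7) 27 = 1 ∧ idealCount (-7) 9 = 1 ∧ idealCount (-7) 3 = 0 ∧
    (189 - 9 * 9) / 4 = 27 := by
  decide +kernel

end Summit.HodgeConjecture.HodgeConjecture.HodgeLocus.Census.LVExponentB
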